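import Summits.Ventures.GridStability.Lyapunov.StructurePreservingPolytope
import Literature.MathematicalPhysics.PowerSystems.PhaseCohesiveEquilibriumUniqueness
import HarnessLib

/-!
# GridStability/Lyapunov/StructurePreservingCrossTerm — the inverse-free LFF CROSS TERM for the
# mixed-order structure-preserving class: `X = Σ_gen Mᵢωᵢφᵢ + ½Σ Dᵢφᵢ²`, its dissipation identity
# `Ẋ = 2K − Π(δ)` (pairing form `Π`), and the strict Lyapunov function `V_h = V + hX`

Cell `gridfusion` (LADDER-GRIDFUSION), seat gridfusion-lyap-1 (g6); lead RULING 6o (3) («the V_h LFF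
flavour: NOT this wave … census sentence suffices») — this file is the NEXT-WAVE GROUNDWORK, typed while
the #91 family was in the referees' hands: the closed-form member of Vu–Turitsyn's family for model-2's
MIXED-ORDER class `StructurePreserving.Params` (first-order load buses break `CB = 0`, so lit-6's (QKH)
layer does not apply; what survives is the energy-plus-cross-term construction below, which needs no
matrix inverse, no LMI and no uniform damping). For `φ = δ − δ₀`, generator speeds `ω`, and the bus
balances `Mᵢaᵢ + Dᵢvᵢ + fᵢ(δ) = P̄ᵢ` (`vᵢ = ωᵢ` on generators):

* `crossTerm p δ₀ (δ, ω) = Σ_{i∈gen} Mᵢωᵢφᵢ + ½Σᵢ Dᵢφᵢ²` and `pairing p δ₀ δ = ½Σᵢⱼ bᵢⱼ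
  (σᵢⱼ − σ*ᵢⱼ)(sin σᵢⱼ − sin σ*ᵢⱼ)`; `pairing_eq_sum` (`= Σᵢ φᵢ(fᵢ(δ) − fᵢ(δ₀))`, model-2's
  `half_sum_sub_mul_antisymm`), `pairing_nonneg` on the closed polytope (lit `sector_nonneg`),
  `pairing_pos_of_ne` (strict inside the polytope off the equilibrium line angles, lit
  `sector_pos_of_abs_add_lt`);
* `fderiv_crossTerm_phaseField` — **the dissipation identity of the cross term** at every phase point:
  `Ẋ = DX(x)·F(x) = 2K(ω) − Π(δ)` (`K = ½Σ_gen Mᵢωᵢ²`; chain rule along the line through `x`, the bus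
  balances `phaseField_balance`, the equilibrium `fᵢ(δ₀) = P̄ᵢ`, the pairing identity);
* `fderiv_vh_phaseField` — for `V_h = V + h·X`:
  `V̇_h = −Σᵢ Dᵢ δ̇ᵢ² + h(2K − Π) = −Σ_{i∉gen} Dᵢδ̇ᵢ² − Σ_{i∈gen}(Dᵢ − hMᵢ)ωᵢ² − h·Π(δ)`
  (`vh_rate_eq`), hence `V̇_h ≤ −h·Π(δ) ≤ 0` on the closed polytope when `0 ≤ h ≤ Dᵢ/Mᵢ` on the
  generators (`fderiv_vh_phaseField_le`) — STRICT in the line angles, which the energy alone is not;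
* `vh_eq` — the completed square `V_h = ½Σ_gen Mᵢ(ωᵢ + hφᵢ)² + ½h·Σᵢ(Dᵢ − hMᵢ)φᵢ² + W(δ)` and
  `potential_le_vh` (`W ≤ V_h` for `0 ≤ h ≤ D/M`): `V_h` is bounded below by the potential, so every
  level/compactness fact of the polytope route (`StructurePreservingPolytope`) transfers.

Not here (next wave): the exponential RATE on the window (`Π ≥ g(θ)·Q`, `V_h ≤ C·(K + Q)` ⇒
`V̇_h ≤ −ρV_h`, solver-free) and the region theorem for `V_h`. THREE COLUMNS: mathematics about MODEL
MV-3 (any damping pattern; `gen = univ` = MV-2L); no certificate data; no sentence here says that any grid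
is stable. Two definitions (`crossTerm`, `pairing`: closed-form functionals); no named fact; standard axioms.
-/

noncomputable section

open Set Filter Topology Real Finset
open Summit.Ventures.GridStability.Models.StructurePreserving
open Summit.Ventures.GridStability.Models.StructurePreserving.Params
open Literature.MathematicalPhysics.PowerSystems (SinusoidalCoupling.sector_nonneg
  SinusoidalCoupling.sector_pos_of_abs_add_lt)

namespace Summit.Ventures.GridStability.Lyapunov.StructurePreserving

variable {n : ℕ}

/-! ### The cross term and the pairing form -/

/-- **The LFF cross term** `X(δ, ω) = Σ_{i∈gen} Mᵢωᵢ(δᵢ − δ₀ᵢ) + ½Σᵢ Dᵢ(δᵢ − δ₀ᵢ)²` (generator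
momentum against angle deviation, plus the D-weighted squared deviation of EVERY bus — the load buses'
first-order dynamics make the second sum the right companion). [folklore] -/
def crossTerm (p : Params n) (δ₀ : Fin n → ℝ) (x : (Fin n → ℝ) × (Fin n → ℝ)) : ℝ :=
  ∑ i ∈ p.gen, p.M i * x.2 i * (x.1 i - δ₀ i) + (1 / 2) * ∑ i, p.D i * (x.1 i - δ₀ i) ^ 2

/-- **The pairing form** `Π(δ) = ½Σᵢⱼ bᵢⱼ (σᵢⱼ − σ*ᵢⱼ)(sin σᵢⱼ − sin σ*ᵢⱼ)`, `σᵢⱼ = δᵢ − δⱼ`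
(the symmetrised `Σᵢ φᵢ(fᵢ(δ) − fᵢ(δ₀))`; nonnegative on Vu–Turitsyn's polytope). [folklore] -/
def pairing (p : Params n) (δ₀ δ : Fin n → ℝ) : ℝ :=
  (1 / 2) * ∑ i, ∑ j, p.b i j * (((δ i - δ j) - (δ₀ i - δ₀ j))
    * (Real.sin (δ i - δ j) - Real.sin (δ₀ i - δ₀ j)))

/-- **Pairing identity**: `Π(δ) = Σᵢ (δᵢ − δ₀ᵢ)(fᵢ(δ) − fᵢ(δ₀))` for symmetric `b` (model-2's
`half_sum_sub_mul_antisymm`). [cite: DorflerChertkovBullo2013, SI §3.1 Lemma 2 (3), proof] -/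
theorem pairing_eq_sum (p : Params n) (hbs : ∀ i j, p.b i j = p.b j i) (δ₀ δ : Fin n → ℝ) :
    pairing p δ₀ δ = ∑ i, (δ i - δ₀ i) * (p.pe δ i - p.pe δ₀ i) := by
  set φ : Fin n → ℝ := fun i => δ i - δ₀ i with hφ
  set A : Fin n → Fin n → ℝ := fun i j => Real.sin (δ i - δ j) - Real.sin (δ₀ i - δ₀ j) with hA
  have hanti : ∀ i j, A j i = -A i j := fun i j => by
    simp only [hA]
    rw [← neg_sub (δ i) (δ j), ← neg_sub (δ₀ i) (δ₀ j), Real.sin_neg, Real.sin_neg]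
    ring
  have hrow : ∀ i, ∑ j, p.b i j * A i j = p.pe δ i - p.pe δ₀ i := fun i => by
    simp only [hA, Params.pe, ← Finset.sum_sub_distrib]
    exact Finset.sum_congr rfl fun j _ => by ring
  have hhalf := half_sum_sub_mul_antisymm p.b A φ hbs hanti
  have hlhs : pairing p δ₀ δ = (1 / 2) * ∑ i, ∑ j, p.b i j * ((φ i - φ j) * A i j) := by
    unfold pairing
    congr 1
    refine Finset.sum_congr rfl fun i _ => Finset.sum_congr rfl fun j _ => ?_
    simp only [hφ, hA]
    ring
  rw [hlhs, hhalf]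
  exact Finset.sum_congr rfl fun i _ => by rw [hrow i]

/-- **`Π ≥ 0` on the closed polytope** (`bᵢⱼ ≥ 0`, `|σ*| ≤ π/2` and `|σ + σ*| ≤ π` on coupled pairs;
lit `sector_nonneg`). [cite: VuTuritsyn2016, §II sector-bound display] -/
theorem pairing_nonneg (p : Params n) (hb : ∀ i j, 0 ≤ p.b i j) {δ₀ δ : Fin n → ℝ}
    (h0 : ∀ i j, p.b i j ≠ 0 → |δ₀ i - δ₀ j| ≤ π / 2)
    (hP : ∀ i j, p.b i j ≠ 0 → |(δ i - δ j) + (δ₀ i - δ₀ j)| ≤ π) : 0 ≤ pairing p δ₀ δ := by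
  unfold pairing
  refine mul_nonneg (by norm_num) (Finset.sum_nonneg fun i _ => Finset.sum_nonneg fun j _ => ?_)
  by_cases hij : p.b i j = 0
  · simp [hij]
  · exact mul_nonneg (hb i j) (SinusoidalCoupling.sector_nonneg (h0 i j hij) (hP i j hij))

/-- **`Π > 0` inside the polytope off the equilibrium line angles**: if some coupled pair has
`σᵢⱼ ≠ σ*ᵢⱼ` then `Π(δ) > 0` (`|σ*| < π/2`, `|σ + σ*| < π`, lit `sector_pos_of_abs_add_lt`) — the
strictness in the line angles that the energy's dissipation `−Σ Dᵢδ̇ᵢ²` lacks.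
[cite: VuTuritsyn2016, Appendix 9.2] -/
theorem pairing_pos_of_ne (p : Params n) (hb : ∀ i j, 0 ≤ p.b i j) {δ₀ δ : Fin n → ℝ}
    (h0 : ∀ i j, p.b i j ≠ 0 → |δ₀ i - δ₀ j| < π / 2)
    (hP : ∀ i j, p.b i j ≠ 0 → |(δ i - δ j) + (δ₀ i - δ₀ j)| < π)
    {a c : Fin n} (hac : p.b a c ≠ 0) (hne : δ a - δ c ≠ δ₀ a - δ₀ c) : 0 < pairing p δ₀ δ := by
  set T : Fin n → Fin n → ℝ := fun i j => p.b i j * (((δ i - δ j) - (δ₀ i - δ₀ j))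
    * (Real.sin (δ i - δ j) - Real.sin (δ₀ i - δ₀ j))) with hT
  have hTnn : ∀ i j, 0 ≤ T i j := by
    intro i j
    by_cases hij : p.b i j = 0
    · simp [hT, hij]
    · exact mul_nonneg (hb i j)
        (SinusoidalCoupling.sector_nonneg (h0 i j hij).le (hP i j hij).le)
  have hTac : 0 < T a c :=
    mul_pos ((hb a c).lt_of_ne (Ne.symm hac))
      (SinusoidalCoupling.sector_pos_of_abs_add_lt (h0 a c hac) (hP a c hac) hne)
  have hsum : T a c ≤ ∑ i, ∑ j, T i j :=
    (Finset.single_le_sum (f := fun j => T a j) (fun j _ => hTnn a j) (Finset.mem_univ c)).trans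
      (Finset.single_le_sum (f := fun i => ∑ j, T i j)
        (fun i _ => Finset.sum_nonneg fun j _ => hTnn i j) (Finset.mem_univ a))
  unfold pairing
  show 0 < (1 / 2) * ∑ i, ∑ j, T i j
  linarith

/-! ### The dissipation identity of the cross term -/

/-- The cross term is `C¹` on the phase space. [folklore] -/
theorem contDiff_crossTerm (p : Params n) (δ₀ : Fin n → ℝ) : ContDiff ℝ 1 (crossTerm p δ₀) := by
  unfold crossTerm
  fun_prop

/-- **Derivative of the cross term along a straight line** in phase space through `(δ, ω)` with
velocity `(a, b)`, at the base point:
`Σ_{gen} Mᵢ(bᵢ(δᵢ − δ₀ᵢ) + ωᵢaᵢ) + Σᵢ Dᵢ(δᵢ − δ₀ᵢ)aᵢ`. [folklore] -/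
theorem hasDerivAt_crossTerm_line (p : Params n) (δ₀ δ ω a b : Fin n → ℝ) :
    HasDerivAt (fun t : ℝ => crossTerm p δ₀ (fun i => δ i + t * a i, fun i => ω i + t * b i))
      (∑ i ∈ p.gen, p.M i * (b i * (δ i - δ₀ i) + ω i * a i)
        + ∑ i, p.D i * ((δ i - δ₀ i) * a i)) 0 := by
  have hlin : ∀ c d : ℝ, HasDerivAt (fun t : ℝ => c + t * d) d 0 := by
    intro c d
    simpa using ((hasDerivAt_id (0 : ℝ)).mul_const d).const_add c
  have h1 : HasDerivAt (fun t : ℝ => ∑ i ∈ p.gen, p.M i * (ω i + t * b i) * ((δ i + t * a i) - δ₀ i))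
      (∑ i ∈ p.gen, p.M i * (b i * (δ i - δ₀ i) + ω i * a i)) 0 := by
    refine HasDerivAt.fun_sum fun i _ => ?_
    have hω := (hlin (ω i) (b i)).const_mul (p.M i)
    have hδ := (hlin (δ i) (a i)).sub_const (δ₀ i)
    refine (hω.mul hδ).congr_deriv ?_
    simp only [zero_mul, add_zero]
    ring
  have h2 : HasDerivAt (fun t : ℝ => (1 / 2) * ∑ i, p.D i * ((δ i + t * a i) - δ₀ i) ^ 2)
      (∑ i, p.D i * ((δ i - δ₀ i) * a i)) 0 := by
    have hsum : HasDerivAt (fun t : ℝ => ∑ i, p.D i * ((δ i + t * a i) - δ₀ i) ^ 2)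
        (∑ i, p.D i * (((2 : ℕ) : ℝ) * ((δ i + 0 * a i) - δ₀ i) ^ (2 - 1) * a i)) 0 := by
      refine HasDerivAt.fun_sum fun i _ => ?_
      exact (((hlin (δ i) (a i)).sub_const (δ₀ i)).fun_pow 2).const_mul (p.D i)
    have h := hsum.const_mul (1 / 2 : ℝ)
    refine h.congr_deriv ?_
    rw [Finset.mul_sum]
    refine Finset.sum_congr rfl fun i _ => ?_
    push_cast
    ring
  exact h1.fun_add h2

/-- **The dissipation identity of the cross term**: for well-formed data and a synchronous
equilibrium `δ₀`, at EVERY phase point `Ẋ(x) = DX(x)·F(x) = 2K(ω) − Π(δ)` — the generator part gives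
`Σ_gen Mᵢωᵢ²` twice over `½`, and the bus balances turn `Σᵢ φᵢ(Mᵢaᵢ + Dᵢvᵢ)` into
`Σᵢ φᵢ(P̄ᵢ − fᵢ(δ)) = −Π(δ)`. [folklore] -/
theorem fderiv_crossTerm_phaseField {p : Params n} (hp : p.WellFormed) {δ₀ : Fin n → ℝ}
    (h₀ : p.IsSyncEquilibrium δ₀) (x : (Fin n → ℝ) × (Fin n → ℝ)) :
    fderiv ℝ (crossTerm p δ₀) x (phaseField p x) = 2 * p.kinetic x.2 - pairing p δ₀ x.1 := by
  set w := phaseField p x with hw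
  have hγ : HasDerivAt (fun t : ℝ =>
      ((fun i => x.1 i + t * w.1 i, fun i => x.2 i + t * w.2 i) : (Fin n → ℝ) × (Fin n → ℝ)))
      w 0 := by
    have h1 : HasDerivAt (fun t : ℝ => fun i => x.1 i + t * w.1 i) w.1 0 :=
      hasDerivAt_pi.2 fun i => by
        simpa using ((hasDerivAt_id (0 : ℝ)).mul_const (w.1 i)).const_add (x.1 i)
    have h2 : HasDerivAt (fun t : ℝ => fun i => x.2 i + t * w.2 i) w.2 0 :=
      hasDerivAt_pi.2 fun i => by
        simpa using ((hasDerivAt_id (0 : ℝ)).mul_const (w.2 i)).const_add (x.2 i)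
    exact h1.prodMk h2
  have hX : DifferentiableAt ℝ (crossTerm p δ₀) x :=
    ((contDiff_crossTerm p δ₀).differentiable one_ne_zero) x
  have hcomp : HasDerivAt (fun t : ℝ => crossTerm p δ₀
      ((fun i => x.1 i + t * w.1 i, fun i => x.2 i + t * w.2 i) : (Fin n → ℝ) × (Fin n → ℝ)))
      (fderiv ℝ (crossTerm p δ₀) x w) 0 :=
    hX.hasFDerivAt.comp_hasDerivAt_of_eq (0 : ℝ) hγ (by simp)
  have hline := hasDerivAt_crossTerm_line p δ₀ x.1 x.2 w.1 w.2
  rw [hcomp.unique hline]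
  -- generator part: `w.1 i = x.2 i` on gen
  have hgen : ∑ i ∈ p.gen, p.M i * (w.2 i * (x.1 i - δ₀ i) + x.2 i * w.1 i)
      = ∑ i ∈ p.gen, p.M i * w.2 i * (x.1 i - δ₀ i) + ∑ i ∈ p.gen, p.M i * x.2 i ^ 2 := by
    rw [← Finset.sum_add_distrib]
    refine Finset.sum_congr rfl fun i hi => ?_
    rw [hw, phaseField_fst_of_mem p x hi]
    ring
  -- `Σ_gen M w.2 φ = Σ_i M w.2 φ` (M = 0 off gen)
  have hMall : ∑ i ∈ p.gen, p.M i * w.2 i * (x.1 i - δ₀ i) = ∑ i, p.M i * w.2 i * (x.1 i - δ₀ i) := by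
    apply Finset.sum_subset (Finset.subset_univ _)
    intro i _ hi
    simp [hp.M_eq_zero i hi]
  -- bus balances and the equilibrium: `Σ_i φ_i (M a + D v) = Σ_i φ_i (f(δ₀) − f(δ))`
  have hbal : ∀ i, p.M i * w.2 i * (x.1 i - δ₀ i) + p.D i * ((x.1 i - δ₀ i) * w.1 i)
      = (x.1 i - δ₀ i) * (p.pe δ₀ i - p.pe x.1 i) := fun i => by
    have h := phaseField_balance hp x i
    rw [← hw] at h
    have : p.M i * w.2 i + p.D i * w.1 i = p.pe δ₀ i - p.pe x.1 i := by rw [h₀ i]; linarith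
    calc p.M i * w.2 i * (x.1 i - δ₀ i) + p.D i * ((x.1 i - δ₀ i) * w.1 i)
        = (x.1 i - δ₀ i) * (p.M i * w.2 i + p.D i * w.1 i) := by ring
      _ = (x.1 i - δ₀ i) * (p.pe δ₀ i - p.pe x.1 i) := by rw [this]
  have hkin : ∑ i ∈ p.gen, p.M i * x.2 i ^ 2 = 2 * p.kinetic x.2 := by
    unfold Params.kinetic; ring
  rw [hgen, hMall, add_assoc, add_comm (∑ i ∈ p.gen, p.M i * x.2 i ^ 2), ← add_assoc,
    ← Finset.sum_add_distrib, Finset.sum_congr rfl fun i _ => hbal i, hkin,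
    pairing_eq_sum p hp.b_symm δ₀ x.1]
  have : ∑ i, (x.1 i - δ₀ i) * (p.pe δ₀ i - p.pe x.1 i)
      = -∑ i, (x.1 i - δ₀ i) * (p.pe x.1 i - p.pe δ₀ i) := by
    rw [← Finset.sum_neg_distrib]
    exact Finset.sum_congr rfl fun i _ => by ring
  rw [this]
  ring

/-! ### The strict Lyapunov function `V_h = V + h·X` -/

/-- **Dissipation of `V_h = V + hX`** at every phase point:
`V̇_h = −Σᵢ Dᵢδ̇ᵢ² + h(2K − Π)`. [folklore] -/
theorem fderiv_vh_phaseField {p : Params n} (hp : p.WellFormed) {δ₀ : Fin n → ℝ}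
    (h₀ : p.IsSyncEquilibrium δ₀) (h : ℝ) (x : (Fin n → ℝ) × (Fin n → ℝ)) :
    fderiv ℝ (fun y => phaseEnergy p δ₀ y + h * crossTerm p δ₀ y) x (phaseField p x)
      = -∑ i, p.D i * (phaseField p x).1 i ^ 2 + h * (2 * p.kinetic x.2 - pairing p δ₀ x.1) := by
  have hV : DifferentiableAt ℝ (phaseEnergy p δ₀) x :=
    ((contDiff_phaseEnergy p δ₀).differentiable one_ne_zero) x
  have hX : DifferentiableAt ℝ (crossTerm p δ₀) x :=
    ((contDiff_crossTerm p δ₀).differentiable one_ne_zero) x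
  have hsum : HasFDerivAt (fun y => phaseEnergy p δ₀ y + h * crossTerm p δ₀ y)
      (fderiv ℝ (phaseEnergy p δ₀) x + h • fderiv ℝ (crossTerm p δ₀) x) x :=
    hV.hasFDerivAt.add (hX.hasFDerivAt.const_mul h)
  rw [hsum.fderiv]
  simp only [FunLike.coe_add, Pi.add_apply, FunLike.coe_smul, Pi.smul_apply, smul_eq_mul]
  rw [fderiv_phaseEnergy_phaseField hp h₀ x, fderiv_crossTerm_phaseField hp h₀ x]

/-- **The rate, bus by bus**: `−Σᵢ Dᵢδ̇ᵢ² + h(2K − Π) = −Σ_{i∉gen} Dᵢδ̇ᵢ² − Σ_{i∈gen}(Dᵢ − hMᵢ)ωᵢ² −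
h·Π(δ)` (`δ̇ᵢ = ωᵢ` on generators). [folklore] -/
theorem vh_rate_eq {p : Params n} (x : (Fin n → ℝ) × (Fin n → ℝ)) (δ₀ : Fin n → ℝ) (h : ℝ) :
    -∑ i, p.D i * (phaseField p x).1 i ^ 2 + h * (2 * p.kinetic x.2 - pairing p δ₀ x.1)
      = -(∑ i ∈ univ \ p.gen, p.D i * (phaseField p x).1 i ^ 2)
        - (∑ i ∈ p.gen, (p.D i - h * p.M i) * x.2 i ^ 2) - h * pairing p δ₀ x.1 := by
  have hsplit : ∑ i, p.D i * (phaseField p x).1 i ^ 2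
      = ∑ i ∈ univ \ p.gen, p.D i * (phaseField p x).1 i ^ 2
        + ∑ i ∈ p.gen, p.D i * (phaseField p x).1 i ^ 2 :=
    (Finset.sum_sdiff (Finset.subset_univ p.gen)).symm
  have hgen : ∑ i ∈ p.gen, p.D i * (phaseField p x).1 i ^ 2 = ∑ i ∈ p.gen, p.D i * x.2 i ^ 2 :=
    Finset.sum_congr rfl fun i hi => by rw [phaseField_fst_of_mem p x hi]
  have hkin : h * (2 * p.kinetic x.2) = ∑ i ∈ p.gen, h * p.M i * x.2 i ^ 2 := by
    unfold Params.kinetic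
    rw [Finset.mul_sum, Finset.mul_sum, Finset.mul_sum]
    exact Finset.sum_congr rfl fun i _ => by ring
  have hcomb : ∑ i ∈ p.gen, (p.D i - h * p.M i) * x.2 i ^ 2
      = ∑ i ∈ p.gen, p.D i * x.2 i ^ 2 - ∑ i ∈ p.gen, h * p.M i * x.2 i ^ 2 := by
    rw [← Finset.sum_sub_distrib]
    exact Finset.sum_congr rfl fun i _ => by ring
  rw [mul_sub, hsplit, hgen, hkin, hcomb]
  ring

/-- **`V_h` decreases on the closed polytope, strictly in the line angles**: for `0 ≤ h` with
`h·Mᵢ ≤ Dᵢ` on the generators, `V̇_h ≤ −h·Π(δ) ≤ 0` wherever `|σ + σ*| ≤ π` on coupled pairs (`b ≥ 0`,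
`|σ*| ≤ π/2`). [folklore] -/
theorem fderiv_vh_phaseField_le {p : Params n} (hp : p.WellFormed) (hb : ∀ i j, 0 ≤ p.b i j)
    {δ₀ : Fin n → ℝ} (h₀ : p.IsSyncEquilibrium δ₀)
    (h0 : ∀ i j, p.b i j ≠ 0 → |δ₀ i - δ₀ j| ≤ π / 2) {h : ℝ} (hh : 0 ≤ h)
    (hhM : ∀ i ∈ p.gen, h * p.M i ≤ p.D i) {x : (Fin n → ℝ) × (Fin n → ℝ)}
    (hP : ∀ i j, p.b i j ≠ 0 → |(x.1 i - x.1 j) + (δ₀ i - δ₀ j)| ≤ π) :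
    fderiv ℝ (fun y => phaseEnergy p δ₀ y + h * crossTerm p δ₀ y) x (phaseField p x)
        ≤ -(h * pairing p δ₀ x.1) ∧
      -(h * pairing p δ₀ x.1) ≤ 0 := by
  have hpair := pairing_nonneg p hb h0 hP
  refine ⟨?_, by nlinarith⟩
  rw [fderiv_vh_phaseField hp h₀ h x, vh_rate_eq x δ₀ h]
  have h1 : 0 ≤ ∑ i ∈ univ \ p.gen, p.D i * (phaseField p x).1 i ^ 2 :=
    Finset.sum_nonneg fun i _ => mul_nonneg (hp.D_pos i).le (sq_nonneg _)
  have h2 : 0 ≤ ∑ i ∈ p.gen, (p.D i - h * p.M i) * x.2 i ^ 2 :=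
    Finset.sum_nonneg fun i hi => mul_nonneg (by linarith [hhM i hi]) (sq_nonneg _)
  linarith

/-- **Completed square**: `V_h = ½Σ_gen Mᵢ(ωᵢ + hφᵢ)² + ½h·Σᵢ(Dᵢ − hMᵢ)φᵢ² + W(δ)` (with `Mᵢ = 0`
off the generators, well-formed data). [folklore] -/
theorem vh_eq {p : Params n} (hp : p.WellFormed) (δ₀ : Fin n → ℝ) (h : ℝ)
    (x : (Fin n → ℝ) × (Fin n → ℝ)) :
    phaseEnergy p δ₀ x + h * crossTerm p δ₀ x
      = (1 / 2) * ∑ i ∈ p.gen, p.M i * (x.2 i + h * (x.1 i - δ₀ i)) ^ 2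
        + (1 / 2) * h * ∑ i, (p.D i - h * p.M i) * (x.1 i - δ₀ i) ^ 2 + p.potential δ₀ x.1 := by
  have hMall : ∑ i ∈ p.gen, p.M i * (x.1 i - δ₀ i) ^ 2 = ∑ i, p.M i * (x.1 i - δ₀ i) ^ 2 := by
    apply Finset.sum_subset (Finset.subset_univ _)
    intro i _ hi
    simp [hp.M_eq_zero i hi]
  have hsq : ∑ i ∈ p.gen, p.M i * (x.2 i + h * (x.1 i - δ₀ i)) ^ 2
      = ∑ i ∈ p.gen, p.M i * x.2 i ^ 2 + 2 * h * ∑ i ∈ p.gen, p.M i * x.2 i * (x.1 i - δ₀ i)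
        + h ^ 2 * ∑ i ∈ p.gen, p.M i * (x.1 i - δ₀ i) ^ 2 := by
    rw [Finset.mul_sum, Finset.mul_sum, ← Finset.sum_add_distrib, ← Finset.sum_add_distrib]
    exact Finset.sum_congr rfl fun i _ => by ring
  have hD : ∑ i, (p.D i - h * p.M i) * (x.1 i - δ₀ i) ^ 2
      = ∑ i, p.D i * (x.1 i - δ₀ i) ^ 2 - h * ∑ i, p.M i * (x.1 i - δ₀ i) ^ 2 := by
    rw [Finset.mul_sum, ← Finset.sum_sub_distrib]
    exact Finset.sum_congr rfl fun i _ => by ring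
  rw [hsq, hMall, hD]
  simp only [phaseEnergy_apply, Params.energy, Params.kinetic, crossTerm]
  ring

/-- **`W ≤ V_h`** for `0 ≤ h` with `h·Mᵢ ≤ Dᵢ` on the generators (and `Dᵢ > 0` everywhere): the
strict Lyapunov function is bounded below by the potential, so it inherits the polytope route's edge
bounds and compactness. [folklore] -/
theorem potential_le_vh {p : Params n} (hp : p.WellFormed) (δ₀ : Fin n → ℝ) {h : ℝ} (hh : 0 ≤ h)
    (hhM : ∀ i ∈ p.gen, h * p.M i ≤ p.D i) (x : (Fin n → ℝ) × (Fin n → ℝ)) :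
    p.potential δ₀ x.1 ≤ phaseEnergy p δ₀ x + h * crossTerm p δ₀ x := by
  rw [vh_eq hp δ₀ h x]
  have h1 : 0 ≤ ∑ i ∈ p.gen, p.M i * (x.2 i + h * (x.1 i - δ₀ i)) ^ 2 :=
    Finset.sum_nonneg fun i hi => mul_nonneg (hp.M_pos i hi).le (sq_nonneg _)
  have h2 : 0 ≤ ∑ i, (p.D i - h * p.M i) * (x.1 i - δ₀ i) ^ 2 := by
    refine Finset.sum_nonneg fun i _ => mul_nonneg ?_ (sq_nonneg _)
    by_cases hi : i ∈ p.gen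
    · linarith [hhM i hi]
    · rw [hp.M_eq_zero i hi, mul_zero, sub_zero]; exact (hp.D_pos i).le
  nlinarith

end Summit.Ventures.GridStability.Lyapunov.StructurePreserving

end
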